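import Summits.QuantumFields.YangMills.Theorems.SwapVirialDeficitSectorLaplaceEndLeaderFubini
import Summits.QuantumFields.YangMills.Theorems.SwapVirialDeficitSigmaBallSmearedSlab
import HarnessLib

/-!
# THE SLAB SIDE OF `stub_end_gaussCore`, END TO END: pointwise fibre bound `hF` (N2) ⟹ `∫⁻_{|δ|<s} g dμ_B ≤ poly/c^{7/2} · (E·900·s^{1/3}(2ρ)^{2/3}/(2ρ)² + s) · ∫_p D·w`
# (skeleton ➎, stub `stub_core_end` → `stub_end_gaussCore` (LEAD sfw-p2 g99 memo11 §1(d)+§3); composition of ✓`lintegral_hubSlab_leader_le` (u-first Tonelli) with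
# ✓`slab_le_smeared` (ball smearing) at `r = B₀`; free-hands support of ⟨stmt-QuantumFields-24197⟩ `SwapVirialDeficit.SwapGluedStiffness`)

* `B0_pos_ae` — LEAD's rate `B₀(δ,x₀,y₀) = 16δ²/(1+δ²) + 8x₀²/((1+x₀²)(1+δ²)) + 4y₀²/(1+y₀²)` is positive off the origin, hence a.e.; `measurable_B0`;
* ★★★ `endGauss_slab_le` — for measurable `g ≥ 0` on `ℝ × GnoCoord L`, a measurable base factor `D(p)` that is `E`-constant on sup-balls of radius `ρ`, and a rate `c > 0`:
  IF `hF` (the hypothesis of ✓`lintegral_hubSlab_leader_le` with `W(t) = D(x₀,y₀)`, `r = B₀`, `c₁ = c₂ = c₃ = c`) holds at every leader point with `|δ| < s`, THEN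
  `∫⁻_{|δ|<s} g dμ_B ≤ ofReal(π²/c·π²/c·2C₃/((1+c)√(1+c))) · (E·ofReal(900 s^{1/3}(2ρ)^{1/3}(2ρ)^{1/3}((2ρ)(2ρ))⁻¹) + ofReal s) · ∫⁻_p D(p)·ofReal((1+x₀²)⁻¹(1+y₀²)⁻¹)`.
The assembler feeds `g = 𝟙_{G♭}·ofReal(e^{−bF̂})`, `c = b/(2·55200L⁶)` (✓`endGauss_exp_three_floor`), `D` = the matched follower factor (N2), and compares `∫ D·w` with the shell
(✓`mbDensity_ge_detFol_rescaled′`, ✓`mbMain_ge_of_subset`, ✓`gaussCore_of_rate`).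

HONEST LABEL: composition of landed measure-theoretic lemmas; `stub_end_gaussCore` (N2 w2, assembly) and stubs core-tip ∕ 001-good, ⟨24197⟩ ∕ ⟨24194⟩ and every rung OPEN; own crux
⟨22884⟩ OPEN (blocked-on ⟨19935⟩); the Yang–Mills mass gap is NOT proved; no summit is proved by a line.  THEOREMS ONLY (0 `def`, 0 `sorry`), standard axioms.
Width seat ym-line-sfw-p2-w3 g67 (cell ym-idea-1, free hands), `--supports stmt-QuantumFields-24197`.  References: [folklore].
-/

set_option autoImplicit false
set_option synthInstance.maxSize 1024

noncomputable section

open MeasureTheory Set Real Metric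
open scoped ENNReal

namespace Summit.QuantumFields.YangMills.Theorems.SwapVirialDeficit.SigmaBall

open Summit.QuantumFields.YangMills.Theorems.SwapVirialDeficit.Gnomonic (gnomonicWeight normSq3)
open Summit.QuantumFields.YangMills.Theorems.SwapVirialDeficit.BlowUpRing

variable {L : ℕ} [NeZero L]

omit [NeZero L] in
/-- LEAD's rate `B₀` is measurable in `p = (δ, x₀, y₀)`. [folklore] -/
theorem measurable_B0 : Measurable fun p : ℝ × ℝ × ℝ =>
    16 * p.1 ^ 2 / (1 + p.1 ^ 2) + 8 * p.2.1 ^ 2 / ((1 + p.2.1 ^ 2) * (1 + p.1 ^ 2)) + 4 * p.2.2 ^ 2 / (1 + p.2.2 ^ 2) := by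
  fun_prop

omit [NeZero L] in
/-- `B₀ > 0` off the origin, hence almost everywhere. [folklore] -/
theorem B0_pos_ae : ∀ᵐ p : ℝ × ℝ × ℝ, 0 < 16 * p.1 ^ 2 / (1 + p.1 ^ 2) + 8 * p.2.1 ^ 2 / ((1 + p.2.1 ^ 2) * (1 + p.1 ^ 2)) + 4 * p.2.2 ^ 2 / (1 + p.2.2 ^ 2) := by
  have hnull : (volume : Measure (ℝ × ℝ × ℝ)) (({(0:ℝ)} : Set ℝ) ×ˢ ((({(0:ℝ)} : Set ℝ)) ×ˢ (({(0:ℝ)} : Set ℝ)))) = 0 := by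
    rw [Measure.volume_eq_prod, Measure.prod_prod, Real.volume_singleton, zero_mul]
  refine (ae_iff.2 (measure_mono_null (fun p hp => ?_) hnull))
  simp only [mem_setOf_eq, not_lt] at hp
  have h1 : 0 ≤ 16 * p.1 ^ 2 / (1 + p.1 ^ 2) := by positivity
  have h2 : 0 ≤ 8 * p.2.1 ^ 2 / ((1 + p.2.1 ^ 2) * (1 + p.1 ^ 2)) := by positivity
  have h3 : 0 ≤ 4 * p.2.2 ^ 2 / (1 + p.2.2 ^ 2) := by positivity
  have e1 : 16 * p.1 ^ 2 / (1 + p.1 ^ 2) = 0 := by linarith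
  have e2 : 8 * p.2.1 ^ 2 / ((1 + p.2.1 ^ 2) * (1 + p.1 ^ 2)) = 0 := by linarith
  have e3 : 4 * p.2.2 ^ 2 / (1 + p.2.2 ^ 2) = 0 := by linarith
  have hd : (0 : ℝ) < 1 + p.1 ^ 2 := by positivity
  have hx : (0 : ℝ) < 1 + p.2.1 ^ 2 := by positivity
  have hy : (0 : ℝ) < 1 + p.2.2 ^ 2 := by positivity
  rw [div_eq_zero_iff] at e1 e2 e3
  have a1 : p.1 = 0 := by rcases e1 with h | h <;> [exact pow_eq_zero_iff (n := 2) (by norm_num) |>.1 (by linarith); exact absurd h hd.ne']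
  have a2 : p.2.1 = 0 := by
    rcases e2 with h | h
    · exact pow_eq_zero_iff (n := 2) (by norm_num) |>.1 (by linarith)
    · exact absurd h (mul_pos hx hd).ne'
  have a3 : p.2.2 = 0 := by rcases e3 with h | h <;> [exact pow_eq_zero_iff (n := 2) (by norm_num) |>.1 (by linarith); exact absurd h hy.ne']
  exact ⟨a1, a2, a3⟩

/-- ★★★ **THE SLAB SIDE OF `stub_end_gaussCore`, END TO END** (✓`lintegral_hubSlab_leader_le` ∘ ✓`slab_le_smeared` at `r = B₀`, `c₁ = c₂ = c₃ = c`). [folklore] -/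
theorem endGauss_slab_le {s ρ c : ℝ} (hs0 : 0 < s) (hs1 : s ≤ 1) (hρ0 : 0 < ρ) (hρ1 : ρ ≤ 1) (hc : 0 < c)
    (g : ℝ × GnoCoord L → ℝ≥0∞) (hg : Measurable g) {E : ℝ≥0∞} (D : ℝ × ℝ → ℝ≥0∞) (hDm : Measurable D)
    (hD : ∀ p p' : ℝ × ℝ, dist p p' < ρ → D p ≤ E * D p')
    (hF : ∀ (u : ℝ × ℝ) (t : Fin 3 → ℝ) (v : Fin 2 → ℝ) (z : Fin 3 → ℝ), t 0 ∈ Ioo (-s) s →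
      ∫⁻ F : Fol L → Fin 3 → ℝ,
          ENNReal.ofReal (((1 + (t 0) ^ 2)⁻¹) ^ 2 * gnoDensity ((((![t 1, u.1, u.2] : Fin 3 → ℝ), (![t 2, v 0, v 1] : Fin 3 → ℝ)), (z, F)) : GnoCoord L)) *
            g (t 0, ((((![t 1, u.1, u.2] : Fin 3 → ℝ), (![t 2, v 0, v 1] : Fin 3 → ℝ)), (z, F)) : GnoCoord L)) ≤
        D (t 1, t 2) *
          ENNReal.ofReal (((1 + t 1 ^ 2 + (u.1 ^ 2 + u.2 ^ 2)) ^ 2)⁻¹ * Real.exp (-(c *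
            (16 * (t 0) ^ 2 / (1 + (t 0) ^ 2) + 8 * (t 1) ^ 2 / ((1 + (t 1) ^ 2) * (1 + (t 0) ^ 2)) + 4 * (t 2) ^ 2 / (1 + (t 2) ^ 2)) *
            (u.1 ^ 2 + u.2 ^ 2) / (1 + t 1 ^ 2 + (u.1 ^ 2 + u.2 ^ 2))))) *
          ENNReal.ofReal (((1 + t 2 ^ 2 + (v 0 ^ 2 + v 1 ^ 2)) ^ 2)⁻¹ * Real.exp (-(c * (v 0 ^ 2 + v 1 ^ 2) / (1 + t 2 ^ 2 + (v 0 ^ 2 + v 1 ^ 2))))) *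
          ENNReal.ofReal (gnomonicWeight z * Real.exp (-(c * normSq3 z / (1 + normSq3 z))))) :
    ∫⁻ p in {p : ℝ × GnoCoord L | p.1 ∈ Ioo (-s) s}, g p ∂((volume : Measure (ℝ × GnoCoord L)).withDensity fun p => ENNReal.ofReal (((1 + p.1 ^ 2)⁻¹) ^ 2 * gnoDensity p.2)) ≤
      ENNReal.ofReal (π ^ 2 / c * (π ^ 2 / c) * (2 * (∫ w : EuclideanSpace ℝ (Fin 3), ((1 + ‖w‖ ^ 2) ^ 2)⁻¹) / ((1 + c) * Real.sqrt (1 + c)))) *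
        ((E * ENNReal.ofReal (900 * s ^ (1 / 3 : ℝ) * (2 * ρ) ^ (1 / 3 : ℝ) * (2 * ρ) ^ (1 / 3 : ℝ) * ((2 * ρ) * (2 * ρ))⁻¹) + ENNReal.ofReal s) *
          ∫⁻ p : ℝ × ℝ, D p * ENNReal.ofReal ((1 + p.1 ^ 2)⁻¹ * (1 + p.2 ^ 2)⁻¹)) := by
  have h1 := lintegral_hubSlab_leader_le (L := L) (S := Ioo (-s) s) measurableSet_Ioo hc hc hc g hg
    (fun p : ℝ × ℝ × ℝ => D p.2) (hDm.comp measurable_snd)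
    (fun p : ℝ × ℝ × ℝ => 16 * p.1 ^ 2 / (1 + p.1 ^ 2) + 8 * p.2.1 ^ 2 / ((1 + p.2.1 ^ 2) * (1 + p.1 ^ 2)) + 4 * p.2.2 ^ 2 / (1 + p.2.2 ^ 2))
    measurable_B0 B0_pos_ae hF
  have h2 := slab_le_smeared hs0 hs1 hρ0 hρ1 D hDm hD (E := E)
  exact h1.trans (mul_le_mul_right h2 _)

end Summit.QuantumFields.YangMills.Theorems.SwapVirialDeficit.SigmaBall

end
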